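import Summits.HodgeConjecture.HodgeConjecture.Theorems.VHCAbelianSchemesRoadIsogenyPushforwardAdmissibilityTransfer
import Summits.Ventures.HSemireg.PerfectComplexSigmaLinks
import Summits.Ventures.HSemireg.HomComplexSigmaOfSchemeIso
import Literature.AlgebraicGeometry.HodgeTheory.ISemiregularOfSchemeIso
import Literature.AlgebraicGeometry.Motives.AbelianVarietyIsogenyPullbackPushforwardHolds
import Literature.AlgebraicGeometry.Motives.AbelianVarietyIsogenyPushforwardLocallyFreeHolds
import HarnessLib

/-!
# Road №4 (`VHCAbelianSchemesRoad`) — THEOREM T (stub (c1) of skeleton v3.9 on crux stmt-HodgeConjecture-26512): the module-level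
# core (M) FOLLOWS from the complex-level core (SC); THEOREM T′ as a kernel theorem of (D), (B), (R), (SC)

research route conditional on HC_CM; not a corollary; Q11.4-sentence-2 already refuted in dim ≥ 3.

Sequel (ring2-b03x gen 13) to `Theorems/VHCAbelianSchemesRoadIsogenyPushforwardAdmissibilityTransfer.lean` (the kernel reduction of
`IsogenyPushforwardAdmissibilityTransferPrime` to the Literature named facts (D) `IsogenyPullbackPushforwardDecomposition`, (B)
`IsogenyPushforwardFiniteLocallyFree` and the typed in-house cores (M) `IsogenyPushforwardSemiregularSheafTransfer`, (R)
`IsogenyPushforwardExtRankTransfer`, (SC) `IsogenyPushforwardISemiregularCTransfer`), kept apart for the 400-line limit.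
`--supports stmt-HodgeConjecture-26512 --as helper`; closes NO stub or item; nothing here says (c1), any stub, 26511 ∕ 26512 ∕ 23176,
`HC_AV`, `HC_CM` or HC holds; HC_CM HELD, by name only; typed ≠ proved.

WHAT IS PROVED (sorry-free; no definition introduced): a complex `E•` with zero terms off degree `0` is `E⁰[0]` up to isomorphism
(the venture's `isoSingle₀OfIsZero`, `PerfectComplexSigmaLinks.lean`), and so is `g_*E•` (`g_*` additive); on a single complex `E₀[0]` the venture's complex-level `I`-semiregularity IS the tree's
module-level one (`HomComplex.isISemiregularC_single₀_iff`, the column anchor, Mathlib's `Ext.homEquiv` and Hartshorne III.6.3 (c));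
`IsISemiregularC` is invariant under isomorphism of complexes (`isISemiregularC_iff_of_iso`). Hence
**`isogenyPushforwardSemiregularSheafTransfer_of_isISemiregularCTransfer : (SC) → (M)`** (the window-`[0,0]` case of (SC)) and
**`isogenyPushforwardAdmissibilityTransferPrime_of_cores' : (D) → (B) → (R) → (SC) → IsogenyPushforwardAdmissibilityTransferPrime`**:
THEOREM T′ hinges on the two published module-level facts and the TWO complex-level in-house cores (R) (the `Ext`-rank transfer =
derived form of (D)) and (SC) (`σ_q` under finite étale push-forward, given (C^∨)) — nothing module-level ∕ single-sheaf remains.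

References: [cite: BuchweitzFlenner2003, Def. 4.1, §5 (I-semiregular) and Thm. 5.1] [cite: Hartshorne1977, III.6.3 (c)]
[cite: MumfordAV1970, §7 Thm. 4 (p. 72)] [cite: GortzWedhorn2020, Prop. 12.13 (p. 410)] [cite: Mukai1978, §3 Prop. 3.12 (p. 249)].
-/

noncomputable section

open CategoryTheory CategoryTheory.Limits AlgebraicGeometry

namespace Summit.HodgeConjecture.HodgeConjecture.Ring2.SemiregularRepresentatives

set_option linter.dupNamespace false -- the cell's namespace repeats the summit name, as in every `Ring2*` file

open Literature.AlgebraicGeometry Literature.AlgebraicGeometry.Motives Literature.AlgebraicGeometry.Motives.AbelianVariety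
open Literature.AlgebraicGeometry.HodgeTheory Literature.AlgebraicGeometry.KTheory

/-! ## Core (M) follows from core (SC): the module-level single-sheaf transfer is the window-`[0,0]` case of the complex-level one

A complex `E•` with zero terms off degree `0` is `E⁰[0]` up to isomorphism (the venture's `isoSingle₀OfIsZero`), and so is `g_*E•`
(`g_*` additive); on a single complex `E₀[0]` the venture's complex-level `I`-semiregularity IS the module-level one
(`HomComplex.isISemiregularC_single₀_iff`, the column anchor), and `IsISemiregularC` is invariant under isomorphism of complexes
(`isISemiregularC_iff_of_iso`). Hence THEOREM T′ is a kernel theorem of (D), (B), (R), (SC) alone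
(`isogenyPushforwardAdmissibilityTransferPrime_of_cores'`). -/

section SingleSheaf

/-- **Core (SC) ⟹ core (M)**: for `E•` with zero terms off degree `0`, window `[0, 0]`, (SC) compares `IsISemiregularC` of `g_*E•` and
`E•`; both are single complexes up to isomorphism (the venture's `isoSingle₀OfIsZero`), where the venture's complex-level `I`-semiregularity is the
module-level one of the degree-`0` term (`HomComplex.isISemiregularC_single₀_iff`). So the Buchweitz–Flenner single-sheaf THEOREM T is
not an independent input. [cite: BuchweitzFlenner2003, Def. 4.1 and §5 (I-semiregular)] -/
theorem isogenyPushforwardSemiregularSheafTransfer_of_isISemiregularCTransfer (hSC : IsogenyPushforwardISemiregularCTransfer) :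
    IsogenyPushforwardSemiregularSheafTransfer := by
  intro A g hg E h0 h₀ h₀' hC J
  letI := HasDerivedCategory.standard A.X.left.Modules
  haveI : E.IsStrictlyGE 0 := by
    rw [CochainComplex.isStrictlyGE_iff]
    intro i hi
    exact h0 i (by omega)
  haveI : E.IsStrictlyLE 0 := by
    rw [CochainComplex.isStrictlyLE_iff]
    intro i hi
    exact h0 i (by omega)
  have h0' : ∀ i : ℤ, i ≠ 0 → IsZero ((endoPushforwardComplex A g E).X i) :=
    fun i hi => isZero_pushforward_of_isZero g (h0 i hi)
  have hE : ∀ i, IsFiniteLocallyFree (E.X i) := fun i =>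
    if hi : i = 0 then by subst hi; exact h₀ else KZero.isFiniteLocallyFree_of_isZero (h0 i hi)
  have hE' : ∀ i, IsFiniteLocallyFree ((endoPushforwardComplex A g E).X i) := fun i =>
    if hi : i = 0 then by subst hi; exact h₀' else KZero.isFiniteLocallyFree_of_isZero (h0' i hi)
  -- the single models and their vector-bundle witnesses, transported along the isomorphisms
  let e := Summit.Ventures.HSemireg.isoSingle₀OfIsZero E h0
  let e' := Summit.Ventures.HSemireg.isoSingle₀OfIsZero (endoPushforwardComplex A g E) h0'
  have hs : ∀ p, IsFiniteLocallyFree ((Summit.Ventures.HSemireg.HomComplex.single₀ A.X.left (E.X 0)).X p) :=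
    fun p => Literature.AlgebraicGeometry.Modules.isFiniteLocallyFree_of_iso ((HomologicalComplex.eval _ _ p).mapIso e) (hE p)
  have hs' : ∀ p, IsFiniteLocallyFree ((Summit.Ventures.HSemireg.HomComplex.single₀ A.X.left
      ((Scheme.Modules.pushforward (Hom.toSchemeHom g)).obj (E.X 0))).X p) :=
    fun p => Literature.AlgebraicGeometry.Modules.isFiniteLocallyFree_of_iso ((HomologicalComplex.eval _ _ p).mapIso e') (hE' p)
  have key := hSC A g hg E 0 0 hE hE' hC J
  rw [Summit.Ventures.HSemireg.HomComplex.isISemiregularC_iff_of_iso A.X 0 0 hE hs e J,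
    Summit.Ventures.HSemireg.HomComplex.isISemiregularC_iff_of_iso A.X 0 0 hE' hs' e' J,
    Summit.Ventures.HSemireg.HomComplex.isISemiregularC_single₀_iff A.X (E.X 0) h₀ hs J,
    Summit.Ventures.HSemireg.HomComplex.isISemiregularC_single₀_iff A.X _ h₀' hs' J] at key
  exact key

/-- **THEOREM T′ as a kernel theorem of (D), (B), (R), (SC)** — the module-level core (M) being derived (§7):
`IsogenyPullbackPushforwardDecomposition → IsogenyPushforwardFiniteLocallyFree → IsogenyPushforwardExtRankTransfer →
IsogenyPushforwardISemiregularCTransfer → IsogenyPushforwardAdmissibilityTransferPrime`. CONDITIONAL on the two Literature named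
facts and the two complex-level in-house cores; nothing else assumed; closes no stub; HC_CM untouched.
[cite: BuchweitzFlenner2003, §3, Def. 4.1 and §5 Thm. 5.1] [cite: MumfordAV1970, §7 Thm. 4 (p. 72)] [cite: GortzWedhorn2020, Prop. 12.13 (p. 410)]
[cite: Mukai1978, §3 Prop. 3.12 (p. 249)] -/
theorem isogenyPushforwardAdmissibilityTransferPrime_of_cores'
    (hD : IsogenyPullbackPushforwardDecomposition) (hB : IsogenyPushforwardFiniteLocallyFree.{0})
    (hR : IsogenyPushforwardExtRankTransfer) (hSC : IsogenyPushforwardISemiregularCTransfer) :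
    IsogenyPushforwardAdmissibilityTransferPrime :=
  isogenyPushforwardAdmissibilityTransferPrime_of_cores hD hB
    (isogenyPushforwardSemiregularSheafTransfer_of_isISemiregularCTransfer hSC) hR hSC

end SingleSheaf

/-! ## Appended: the cores HOLD IN DEGREE ONE (PROVED) — for an isogeny which is an isomorphism of the underlying schemes

For `g` an automorphism, `Ker g(ℂ) = 1` and (C^∨) is vacuous; the cores (R), (SC), (M) then say that `g_*` — push-forward along an
isomorphism `e := Over.isoMk (asIso g)` of `ℂ`-schemes with `e.hom.left = g` definitionally — preserves all `Ext`-ranks, complex-level and module-level `I`-semiregularity: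
the venture's `extRank_pushforward_eq`, `HomComplex.isISemiregularC_pushforward_iff` and the Literature's `IsISemiregular.of_schemeIso`
(transport along scheme ISOMORPHISMS, pieces (N1)–(N5)). So the content of the cores is exactly the degree-`> 1` phenomenon (the kernel
translations `τ_x`, `x ≠ 1`), as (C^∨) indicates. -/

section DegreeOne

variable {A : AbelianVariety ℂ} (g : A ⟶ A) [IsIso (Hom.toSchemeHom g)]

/-- **Core (R) in degree one (PROVED)**: for an isogeny `g` which is an isomorphism of schemes, `rank Ext^k(g_*E•, g_*E•) =
rank Ext^k(E•, E•)` for every complex `E•` and every `k` — the venture's `extRank_pushforward_eq` for the inverse automorphism.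
[cite: Lieblich2006, Prop. 2.1.9 (reading: Ext-groups along an equivalence)] [cite: Orlov2002DerivedAbelian, p. 3 L33–40] -/
theorem isogenyPushforwardExtRankTransfer_of_isIso (E : CochainComplex A.X.left.Modules ℤ) (k : ℤ) :
    Summit.Ventures.HSemireg.extRank A.X (endoPushforwardComplex A g E) k = Summit.Ventures.HSemireg.extRank A.X E k :=
  Summit.Ventures.HSemireg.extRank_pushforward_eq (Over.isoMk (asIso (Hom.toSchemeHom g)) (Over.w g.hom.hom.hom) : A.X ≅ A.X).symm E k

/-- **Core (SC) in degree one (PROVED)**: for an isogeny `g` which is an isomorphism of schemes, `(σ_q^{g_*E•})_{q ∈ J}` is jointly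
injective iff `(σ_q^{E•})_{q ∈ J}` is — the venture's `HomComplex.isISemiregularC_pushforward_iff` (pieces (N1)–(N5) along the scheme
isomorphism underlying `g`). [cite: BuchweitzFlenner2003, Def. 4.1 and §5 (I-semiregular)] -/
theorem isogenyPushforwardISemiregularCTransfer_of_isIso (E : CochainComplex A.X.left.Modules ℤ) (a b : ℤ) [E.IsStrictlyGE a]
    [E.IsStrictlyLE b] (hE : ∀ i, IsFiniteLocallyFree (E.X i))
    (hE' : ∀ i, IsFiniteLocallyFree ((endoPushforwardComplex A g E).X i)) (J : Set ℕ) :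
    letI := HasDerivedCategory.standard A.X.left.Modules
    Summit.Ventures.HSemireg.HomComplex.IsISemiregularC A.X (endoPushforwardComplex A g E) a b hE' J ↔
      Summit.Ventures.HSemireg.HomComplex.IsISemiregularC A.X E a b hE J := by
  letI := HasDerivedCategory.standard A.X.left.Modules
  exact Summit.Ventures.HSemireg.HomComplex.isISemiregularC_pushforward_iff
    (Over.isoMk (asIso (Hom.toSchemeHom g)) (Over.w g.hom.hom.hom) : A.X ≅ A.X) E a b hE hE' J

/-- **Core (M) in degree one (PROVED)**: for an isogeny `g` which is an isomorphism of schemes and a vector bundle `F`, `g_*F` is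
`J`-semiregular iff `F` is — the Literature's `IsISemiregular.of_schemeIso` along the scheme isomorphism underlying `g` and along its
inverse (`g⁻¹_*g_*F ≅ F`, `isISemiregular_iff_of_iso`). [cite: BuchweitzFlenner2003, §5 (I-semiregular)] -/
theorem isogenyPushforwardSemiregularSheafTransfer_of_isIso (F : A.X.left.Modules) (hF : IsFiniteLocallyFree F)
    (hF' : IsFiniteLocallyFree ((Scheme.Modules.pushforward (Hom.toSchemeHom g)).obj F)) (J : Set ℕ) :
    IsISemiregular hF' J ↔ IsISemiregular hF J := by
  let e : A.X ≅ A.X := Over.isoMk (asIso (Hom.toSchemeHom g)) (Over.w g.hom.hom.hom)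
  refine ⟨fun h => ?_, fun h => IsISemiregular.of_schemeIso e hF h⟩
  -- back along `e⁻¹`: `(e⁻¹)_*(e_*F) ≅ F`
  have h' := IsISemiregular.of_schemeIso e.symm hF' h
  exact (isISemiregular_iff_of_iso (Literature.AlgebraicGeometry.Modules.isoPushforwardInvPushforward (leftIso' e) F).symm
    (hF'.pushforward_of_iso (leftIso' e.symm)) hF J).1 h'

end DegreeOne

/-! ## Appended: PIECE (D) DISCHARGED BY NAME — THEOREM T′ displays THREE pieces (B), (R), (SC)

Piece (D) `IsogenyPullbackPushforwardDecomposition` (`g^*g_*F ≅ ∐_{x ∈ Ker g(ℂ)} τ_x^*F` for vector bundles `F` along an isogeny of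
complex abelian varieties) is now a THEOREM of the tree: `isogenyPullbackPushforwardDecomposition_holds`
(`Literature/AlgebraicGeometry/Motives/AbelianVarietyIsogenyPullbackPushforwardHolds.lean`, module Chase–Harrison–Rosenberg on the affine
charts of `A ∕ Ker g`). Specialising the reassembly of record `isogenyPushforwardAdmissibilityTransferPrime_of_cores'` at it, THEOREM T′
becomes a kernel theorem of the ONE Literature named fact (B) `IsogenyPushforwardFiniteLocallyFree` and the TWO complex-level in-house
cores (R) `IsogenyPushforwardExtRankTransfer`, (SC) `IsogenyPushforwardISemiregularCTransfer` (director-hodge g14 R14.26 (3); seat core-R).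
CONDITIONAL on exactly these three displayed hypotheses; closes no stub; nothing here says (B), (R), (SC), T, 26512 or HC_CM holds. -/

section ThreePieces

/-- **THEOREM T′ as a kernel theorem of (B), (R), (SC)** — piece (D) discharged by the tree's theorem
`isogenyPullbackPushforwardDecomposition_holds`: `IsogenyPushforwardFiniteLocallyFree → IsogenyPushforwardExtRankTransfer →
IsogenyPushforwardISemiregularCTransfer → IsogenyPushforwardAdmissibilityTransferPrime` (the «`…_of_cores″`» of director-hodge g14
R14.26 (3), spelt with two ASCII primes). CONDITIONAL on the Literature named fact (B) (Görtz–Wedhorn I Prop. 12.13 with 12.19) and the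
two complex-level in-house cores; nothing else assumed; closes no stub; HC_CM untouched. [cite: MumfordAV1970, §7 Thm. 4 (p. 72)]
[cite: GortzWedhorn2020, Prop. 12.13 (p. 410) with Prop. 12.19 (p. 413)] [cite: BuchweitzFlenner2003, §3, Def. 4.1 and §5 Thm. 5.1]
[cite: Mukai1978, §3 Prop. 3.12 (p. 249)] -/
theorem isogenyPushforwardAdmissibilityTransferPrime_of_cores''
    (hB : IsogenyPushforwardFiniteLocallyFree.{0}) (hR : IsogenyPushforwardExtRankTransfer)
    (hSC : IsogenyPushforwardISemiregularCTransfer) : IsogenyPushforwardAdmissibilityTransferPrime :=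
  isogenyPushforwardAdmissibilityTransferPrime_of_cores' isogenyPullbackPushforwardDecomposition_holds hB hR hSC

end ThreePieces

/-! ## Appended: PIECE (B) DISCHARGED BY NAME — THEOREM T′ displays TWO pieces (R), (SC)

Piece (B) `IsogenyPushforwardFiniteLocallyFree` (the direct image `g_*F` of a vector bundle `F` along an isogeny `g : A → B` of abelian
varieties is a vector bundle; Görtz–Wedhorn I Prop. 12.13 with Prop. 12.19) is now a THEOREM of the tree, over every field:
`isogenyPushforwardFiniteLocallyFree_holds` (`Literature/AlgebraicGeometry/Motives/AbelianVarietyIsogenyPushforwardLocallyFreeHolds.lean`;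
`g` is finite by definition and flat by the tree's `IsIsogeny.flat`, `B` is locally noetherian, and `IsFiniteLocallyFree.pushforward_of_isFinite_of_flat`
of `Literature/AlgebraicGeometry/Modules/PushforwardFiniteLocallyFree.lean` — affine-locally, finite projective sections over the finite flat =
finite projective algebra `Γ(A, g⁻¹V)` are finite projective over `Γ(B, V)`, Görtz–Wedhorn I Cor. 7.42, Stacks 00NX). Specialising
`isogenyPushforwardAdmissibilityTransferPrime_of_cores''` at it, THEOREM T′ becomes a kernel theorem of exactly the TWO complex-level in-house
cores (R) `IsogenyPushforwardExtRankTransfer` and (SC) `IsogenyPushforwardISemiregularCTransfer` (director-hodge g14 R14.24, seat core-B).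
CONDITIONAL on exactly these two displayed hypotheses; closes no stub; nothing here says (R), (SC), T, 26512 or HC_CM holds. -/

section TwoPieces

/-- **THEOREM T′ as a kernel theorem of (R), (SC)** — pieces (D) and (B) discharged by the tree's theorems
`isogenyPullbackPushforwardDecomposition_holds` and `isogenyPushforwardFiniteLocallyFree_holds`:
`IsogenyPushforwardExtRankTransfer → IsogenyPushforwardISemiregularCTransfer → IsogenyPushforwardAdmissibilityTransferPrime` (spelt with
three ASCII primes). CONDITIONAL on the two complex-level in-house cores only; no Literature named fact remains among the hypotheses;
nothing else assumed; closes no stub; HC_CM untouched. [cite: MumfordAV1970, §7 Thm. 4 (p. 72)]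
[cite: GortzWedhorn2020, Prop. 12.13 (p. 410) with Prop. 12.19 (p. 413)] [cite: BuchweitzFlenner2003, §3, Def. 4.1 and §5 Thm. 5.1]
[cite: Mukai1978, §3 Prop. 3.12 (p. 249)] -/
theorem isogenyPushforwardAdmissibilityTransferPrime_of_cores'''
    (hR : IsogenyPushforwardExtRankTransfer) (hSC : IsogenyPushforwardISemiregularCTransfer) :
    IsogenyPushforwardAdmissibilityTransferPrime :=
  isogenyPushforwardAdmissibilityTransferPrime_of_cores'' isogenyPushforwardFiniteLocallyFree_holds hR hSC

end TwoPieces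

end Summit.HodgeConjecture.HodgeConjecture.Ring2.SemiregularRepresentatives

end
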